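import Summits.QuantumFields.YangMills.Theorems.PoincareLipschitzQuaternionCurrentsHSystem
import Literature.Analysis.PDE.HarmonicMapMinimisers
import HarnessLib

/-!
# Crux `BlockLipschitzL` (stmt-QuantumFields-23533) ∕ `HistoryTailL` (stmt-QuantumFields-19936), LINE 25 «CompactnessTransfer»,
# the (TM) road, ROAD (H) «SU(2) CURRENTS ⇒ H-SYSTEM ⇒ 8π QUANTUM» — brick (K) «THE 8π GAP FROM THE H-SYSTEM QUANTUM: THE DOOR»

Cell `ym3-torus` (YM ladder rung R3 = continuum SU(2) Yang–Mills on T³ — a RUNG, NOT Clay: not d = 4, not infinite volume,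
not a mass gap); WIDTH helper seat `ym3-torus-px19` g8 (road memo `ROAD-TM-HSYSTEM-px19g8.md` = 23533 evidence; ARCHITECTURE v1
16:14Z); `--supports stmt-QuantumFields-23533`; THEOREMS ONLY (0 `def`, 0 `sorry`, default heartbeats); imports this seat's ✓(Q) FILES 1–2
(quaternionic currents ⇒ H-system rows) and lit `HarmonicMapMinimisers` for the NAMED PRINTED FACT
`Literature.Analysis.PDE.HSystemEnergyQuantization` ([BrezisCoron1985, Appendix, Lemma A.1 = Lemma 0.1] — the H-system energy
quantum for `W^{1,2}_loc(ℝ²; ℝ³)` weak solutions exactly as printed: NO a-priori regularity, Wente's lemma being INSIDE their proof;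
vended by ★w3 g15∕g16, text = the candidate binder 83add449).

WHAT THIS FILE PROVES.  ★★★ `gap_of_hSystemQuantization_of_doors (hF) (hT) (hH) : ⟨(GAP)⟩` — px3 g9's FROZEN (GAP) binder text
(`GAP-binder-text.FROZEN.px3g9.txt` sha16 30a3f4556be5a68a, the ONE hypothesis of ✓`uniformSmallScaleEnergy_band_of_gap` = registered
S1″): «a map of the minimising class `Q → S³` whose central ball energies are LINEAR, `E(B_r(0)) = Θ·r` for `r ≤ 1∕2`, with `Θ ≤ 3π`,
has `Θ = 0`», FROM three rows:
* `hF : Literature.Analysis.PDE.HSystemEnergyQuantization` — the named printed fact (F);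
* `hT` — THE TRANSPORT DOOR (brick (T), px14 g7 ∕ px16 g10): the class row + linear central energies ⟹ a LINK `w : ℝ² → S³` (the cone read
  in the stereographic × radial chart) which is Sobolev on `ℝ²`, unit everywhere, of energy `∫|∇w|² = Θ`, and satisfies the 2-d sphere
  conservation laws (= w7's ✓`weaklyHarmonic_of_cubeMinimiser`, transported);
* `hH` — THE STREAM-FUNCTION DOOR (brick (H), px5 g9, `ℝ³`-bundle form): three `L²` weakly divergence-free fields on `ℝ²` are the rotated
  gradients of a Sobolev map `B : ℝ² → ℝ³`.
PROOF.  (Q1) the three left currents `A^a` of `w` are div-free ⟹ (hH) stream functions `B`; (Q4) `B` solves the H-system rows with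
`∫|∇B|² = ∫|∇w|² = Θ` (Q2, T); (hF) `Θ = 8πk`, `k ∈ ℕ`; `Θ ≤ 3π < 8π` ⟹ `k = 0` ⟹ `Θ = 0`.  When (T) and (H) land, `hT`, `hH` are
discharged by name and (GAP) ⟸ `HSystemEnergyQuantization` ALONE; then S1″ (px3's door), `BlockLipschitzL` (LEAD's K-13∕K-14 knit).
HONEST SCOPE.  A conditional knit: (GAP)∕(TM) NOT proved unconditionally here; (F) is a NAMED PRINTED FACT; (T), (H) are HYPOTHESES;
S1″, K1, `MeanDeviationL`, `BlockLipschitzL`, `HistoryTailL` NOT proved.  YM₃ on T³ is rung R3, not Clay; YM gap NOT proved.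

References: H. Brezis, J.-M. Coron, *Convergence of solutions of H-systems or how to blow bubbles*, Arch. Rational Mech. Anal. 89 (1985)
21–56 [BrezisCoron1985] (Appendix, Lemma A.1, (A.1)–(A.4), p. 47–48; = Lemma 0.1 p. 22); H. C. Wente, J. Math. Anal. Appl. 26 (1969)
318–344 (regularity of weak H-surfaces, inside BC85's proof); R. Schoen, K. Uhlenbeck, Invent. Math. 78 (1984) [SchoenUhlenbeck1984]
(Lemma 1.1, Prop. 1.2 — the statement this road re-derives for `Θ ≤ 3π`).
-/

set_option autoImplicit false

noncomputable section

open MeasureTheory Set Function Filter Topology Metric TopologicalSpace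
open scoped ContDiff ENNReal BigOperators RealInnerProductSpace

namespace Summit.QuantumFields.YangMills.Theorems.PoincareLipschitzGapOfHSystemQuantization

open Literature.Analysis.FunctionSpaces
open Summit.QuantumFields.YangMills.Theorems.PoincareLipschitzQuaternionCurrents
open Summit.QuantumFields.YangMills.Theorems.PoincareLipschitzQuaternionCurrentsHSystem

/-- Arithmetic letter: `8πk ≤ 3π` with `k ∈ ℕ` forces `k = 0`. [folklore] -/
theorem nat_eq_zero_of_eight_pi_mul_le (k : ℕ) (h : 8 * Real.pi * k ≤ 3 * Real.pi) : k = 0 := by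
  have hπ := Real.pi_pos
  have hk : (k : ℝ) < 1 := by nlinarith
  exact_mod_cast Nat.lt_one_iff.mp (by exact_mod_cast hk)

/-- ★★★ **THE `8π` GAP OF MINIMIZING TANGENT MAPS `ℝ³ → S³`, FROM THE H-SYSTEM QUANTUM — THE DOOR.**  Conclusion = px3 g9's FROZEN
(GAP) binder text (sha16 30a3f4556be5a68a) VERBATIM; hypotheses = the named fact (F) and the two doors (T) (cone → plane transport) and
(H) (planar stream functions, `ℝ³`-bundle), each stated in the letters its brick proves. [cite: BrezisCoron1985, Appendix, Lemma A.1; SchoenUhlenbeck1984, Lemma 1.1 and Proposition 1.2] -/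
theorem gap_of_hSystemQuantization_of_doors (hF : Literature.Analysis.PDE.HSystemEnergyQuantization)
    (hT : ∀ (hQ : IsOpen {x : EuclideanSpace ℝ (Fin 3) | ∀ i : Fin 3, |x i| < 1}) (U : EuclideanSpace ℝ (Fin 3) → EuclideanSpace ℝ (Fin 4)) (G : EuclideanSpace ℝ (Fin 3) → (EuclideanSpace ℝ (Fin 3) →L[ℝ] EuclideanSpace ℝ (Fin 4))),
      (HasWeakFDerivOn ⟨{x : EuclideanSpace ℝ (Fin 3) | ∀ i : Fin 3, |x i| < 1}, hQ⟩ volume U G ∧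
        (∀ x : EuclideanSpace ℝ (Fin 3), (∀ i : Fin 3, |x i| < 1) → ‖U x‖ = 1) ∧
        IntegrableOn (fun x => ∑ i : Fin 3, ‖G x (EuclideanSpace.single i (1:ℝ))‖ ^ 2) {x : EuclideanSpace ℝ (Fin 3) | ∀ i : Fin 3, |x i| < 1} ∧
        (∀ (y : EuclideanSpace ℝ (Fin 3)) (ρ : ℝ), 0 < ρ → closedBall y ρ ⊆ {x : EuclideanSpace ℝ (Fin 3) | ∀ i : Fin 3, |x i| < 1} →
          ∀ (W : EuclideanSpace ℝ (Fin 3) → EuclideanSpace ℝ (Fin 4)) (GW : EuclideanSpace ℝ (Fin 3) → (EuclideanSpace ℝ (Fin 3) →L[ℝ] EuclideanSpace ℝ (Fin 4))),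
          HasWeakFDerivOn ⟨{x : EuclideanSpace ℝ (Fin 3) | ∀ i : Fin 3, |x i| < 1}, hQ⟩ volume W GW →
          (∀ x : EuclideanSpace ℝ (Fin 3), (∀ i : Fin 3, |x i| < 1) → ‖W x‖ = 1) →
          IntegrableOn (fun x => ∑ i : Fin 3, ‖GW x (EuclideanSpace.single i (1:ℝ))‖ ^ 2) {x : EuclideanSpace ℝ (Fin 3) | ∀ i : Fin 3, |x i| < 1} →
          (∃ ρ' : ℝ, ρ' < ρ ∧ ∀ x : EuclideanSpace ℝ (Fin 3), x ∉ ball y ρ' → W x = U x) →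
          ∫ x in ball y ρ, ∑ i : Fin 3, ‖G x (EuclideanSpace.single i (1:ℝ))‖ ^ 2 ≤ ∫ x in ball y ρ, ∑ i : Fin 3, ‖GW x (EuclideanSpace.single i (1:ℝ))‖ ^ 2)) →
      ∀ Θ : ℝ, (∀ r : ℝ, 0 < r → r ≤ 1 / 2 → ∫ x in ball (0 : EuclideanSpace ℝ (Fin 3)) r, ∑ i : Fin 3, ‖G x (EuclideanSpace.single i (1:ℝ))‖ ^ 2 = Θ * r) →
      ∃ (w : EuclideanSpace ℝ (Fin 2) → EuclideanSpace ℝ (Fin 4)) (Gw : EuclideanSpace ℝ (Fin 2) → (EuclideanSpace ℝ (Fin 2) →L[ℝ] EuclideanSpace ℝ (Fin 4))),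
        HasWeakFDerivOn ⟨Set.univ, isOpen_univ⟩ volume w Gw ∧ (∀ y, ‖w y‖ = 1) ∧
        Integrable (fun y => ∑ k : Fin 2, ‖Gw y (EuclideanSpace.single k (1:ℝ))‖ ^ 2) volume ∧
        (∫ y, ∑ k : Fin 2, ‖Gw y (EuclideanSpace.single k (1:ℝ))‖ ^ 2 = Θ) ∧
        (∀ (p q : EuclideanSpace ℝ (Fin 4)), ‖p‖ = 1 → ‖q‖ = 1 → ⟪p, q⟫ = 0 →
          ∀ η : EuclideanSpace ℝ (Fin 2) → ℝ, ContDiff ℝ ∞ η → HasCompactSupport η →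
            ∫ y, ∑ k : Fin 2, fderiv ℝ η y (EuclideanSpace.single k (1:ℝ)) *
              (⟪p, w y⟫ * ⟪Gw y (EuclideanSpace.single k (1:ℝ)), q⟫ - ⟪q, w y⟫ * ⟪Gw y (EuclideanSpace.single k (1:ℝ)), p⟫) = 0))
    (hH : ∀ (A : Fin 3 → EuclideanSpace ℝ (Fin 2) → EuclideanSpace ℝ (Fin 2)),
      (∀ a, AEStronglyMeasurable (A a) volume) → (∀ a, Integrable (fun y => ‖A a y‖ ^ 2) volume) →
      (∀ a (η : EuclideanSpace ℝ (Fin 2) → ℝ), ContDiff ℝ ∞ η → HasCompactSupport η →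
        ∫ y, ∑ k : Fin 2, fderiv ℝ η y (EuclideanSpace.single k (1:ℝ)) * A a y k = 0) →
      ∃ (B : EuclideanSpace ℝ (Fin 2) → EuclideanSpace ℝ (Fin 3))
        (GB : EuclideanSpace ℝ (Fin 2) → (EuclideanSpace ℝ (Fin 2) →L[ℝ] EuclideanSpace ℝ (Fin 3))),
        HasWeakFDerivOn ⟨Set.univ, isOpen_univ⟩ volume B GB ∧
        (∀ y a, (GB y (EuclideanSpace.single 0 (1:ℝ))) a = -A a y 1 ∧ (GB y (EuclideanSpace.single 1 (1:ℝ))) a = A a y 0) ∧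
        Integrable (fun y => ∑ k : Fin 2, ‖GB y (EuclideanSpace.single k (1:ℝ))‖ ^ 2) volume) :
    ∀ (hQ : IsOpen {x : EuclideanSpace ℝ (Fin 3) | ∀ i : Fin 3, |x i| < 1}) (U : EuclideanSpace ℝ (Fin 3) → EuclideanSpace ℝ (Fin 4)) (G : EuclideanSpace ℝ (Fin 3) → (EuclideanSpace ℝ (Fin 3) →L[ℝ] EuclideanSpace ℝ (Fin 4))),
      (HasWeakFDerivOn ⟨{x : EuclideanSpace ℝ (Fin 3) | ∀ i : Fin 3, |x i| < 1}, hQ⟩ volume U G ∧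
        (∀ x : EuclideanSpace ℝ (Fin 3), (∀ i : Fin 3, |x i| < 1) → ‖U x‖ = 1) ∧
        IntegrableOn (fun x => ∑ i : Fin 3, ‖G x (EuclideanSpace.single i (1:ℝ))‖ ^ 2) {x : EuclideanSpace ℝ (Fin 3) | ∀ i : Fin 3, |x i| < 1} ∧
        (∀ (y : EuclideanSpace ℝ (Fin 3)) (ρ : ℝ), 0 < ρ → closedBall y ρ ⊆ {x : EuclideanSpace ℝ (Fin 3) | ∀ i : Fin 3, |x i| < 1} →
          ∀ (W : EuclideanSpace ℝ (Fin 3) → EuclideanSpace ℝ (Fin 4)) (GW : EuclideanSpace ℝ (Fin 3) → (EuclideanSpace ℝ (Fin 3) →L[ℝ] EuclideanSpace ℝ (Fin 4))),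
          HasWeakFDerivOn ⟨{x : EuclideanSpace ℝ (Fin 3) | ∀ i : Fin 3, |x i| < 1}, hQ⟩ volume W GW →
          (∀ x : EuclideanSpace ℝ (Fin 3), (∀ i : Fin 3, |x i| < 1) → ‖W x‖ = 1) →
          IntegrableOn (fun x => ∑ i : Fin 3, ‖GW x (EuclideanSpace.single i (1:ℝ))‖ ^ 2) {x : EuclideanSpace ℝ (Fin 3) | ∀ i : Fin 3, |x i| < 1} →
          (∃ ρ' : ℝ, ρ' < ρ ∧ ∀ x : EuclideanSpace ℝ (Fin 3), x ∉ ball y ρ' → W x = U x) →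
          ∫ x in ball y ρ, ∑ i : Fin 3, ‖G x (EuclideanSpace.single i (1:ℝ))‖ ^ 2 ≤ ∫ x in ball y ρ, ∑ i : Fin 3, ‖GW x (EuclideanSpace.single i (1:ℝ))‖ ^ 2)) →
      ∀ Θ : ℝ, (∀ r : ℝ, 0 < r → r ≤ 1 / 2 → ∫ x in ball (0 : EuclideanSpace ℝ (Fin 3)) r, ∑ i : Fin 3, ‖G x (EuclideanSpace.single i (1:ℝ))‖ ^ 2 = Θ * r) →
        Θ ≤ 3 * Real.pi → Θ = 0 := by
  intro hQ U G hcls Θ hlin hΘ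
  -- (T): the link
  obtain ⟨w, Gw, hw, hw1, hE, hEΘ, hcl⟩ := hT hQ U G hcls Θ hlin
  -- the currents, hypothesis-pinned
  set J : Fin 4 → Fin 4 → EuclideanSpace ℝ (Fin 2) → Fin 2 → ℝ :=
    fun m n y k => w y m * Gw y (EuclideanSpace.single k (1:ℝ)) n - w y n * Gw y (EuclideanSpace.single k (1:ℝ)) m with hJdef
  have hJ : ∀ m n y k, J m n y k = w y m * Gw y (EuclideanSpace.single k (1:ℝ)) n - w y n * Gw y (EuclideanSpace.single k (1:ℝ)) m :=
    fun _ _ _ _ => rfl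
  set A : Fin 3 → EuclideanSpace ℝ (Fin 2) → Fin 2 → ℝ :=
    fun a y k => if a = 0 then J 0 1 y k - J 2 3 y k else if a = 1 then J 0 2 y k - J 3 1 y k else J 0 3 y k - J 1 2 y k with hAdef
  have hA : ∀ y k, A 0 y k = J 0 1 y k - J 2 3 y k ∧ A 1 y k = J 0 2 y k - J 3 1 y k ∧ A 2 y k = J 0 3 y k - J 1 2 y k :=
    fun y k => ⟨by simp [hAdef], by simp [hAdef], by simp [hAdef]⟩
  -- the `ℝ²`-valued bundle of the currents, for (H)
  set A' : Fin 3 → EuclideanSpace ℝ (Fin 2) → EuclideanSpace ℝ (Fin 2) :=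
    fun a y => A a y 0 • EuclideanSpace.single (0 : Fin 2) (1:ℝ) + A a y 1 • EuclideanSpace.single (1 : Fin 2) (1:ℝ) with hA'def
  have hA'0 : ∀ a y, A' a y 0 = A a y 0 := fun a y => by simp [hA'def]
  have hA'1 : ∀ a y, A' a y 1 = A a y 1 := fun a y => by simp [hA'def]
  have hA'k : ∀ a y (k : Fin 2), A' a y k = A a y k := fun a y k => by
    fin_cases k
    · exact hA'0 a y
    · exact hA'1 a y
  -- measurability of the currents
  have hwm := aestronglyMeasurable_of_sobolev hw
  have hGm := aestronglyMeasurable_grad hw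
  have hcoord : ∀ m : Fin 4, AEStronglyMeasurable (fun y => w y m) volume := fun m =>
    (EuclideanSpace.proj m : EuclideanSpace ℝ (Fin 4) →L[ℝ] ℝ).continuous.comp_aestronglyMeasurable hwm
  have hgcoord : ∀ (k : Fin 2) (m : Fin 4), AEStronglyMeasurable (fun y => Gw y (EuclideanSpace.single k (1:ℝ)) m) volume :=
    fun k m => (memLp_grad_coord hw hE k m).1
  have hJm : ∀ m n k, AEStronglyMeasurable (fun y => J m n y k) volume := fun m n k =>
    ((hcoord m).mul (hgcoord k n)).sub ((hcoord n).mul (hgcoord k m))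
  have hAm : ∀ a k, AEStronglyMeasurable (fun y => A a y k) volume := by
    intro a k
    fin_cases a
    · exact ((hJm 0 1 k).sub (hJm 2 3 k)).congr (Filter.Eventually.of_forall fun y => ((hA y k).1).symm)
    · exact ((hJm 0 2 k).sub (hJm 3 1 k)).congr (Filter.Eventually.of_forall fun y => ((hA y k).2.1).symm)
    · exact ((hJm 0 3 k).sub (hJm 1 2 k)).congr (Filter.Eventually.of_forall fun y => ((hA y k).2.2).symm)
  have hA'm : ∀ a, AEStronglyMeasurable (A' a) volume := fun a =>
    ((hAm a 0).smul_const _).add ((hAm a 1).smul_const _)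
  -- `‖A' a‖² ≤ |∇w|²` a.e., hence integrable
  have hen := leftCurrents_energy_ae hw hw1 hJ hA
  have hA'i : ∀ a, Integrable (fun y => ‖A' a y‖ ^ 2) volume := by
    intro a
    refine hE.mono' ((continuous_pow 2).comp_aestronglyMeasurable (hA'm a).norm) (hen.mono fun y hy => ?_)
    have hsq : ‖A' a y‖ ^ 2 = A a y 0 ^ 2 + A a y 1 ^ 2 := by
      rw [EuclideanSpace.norm_sq_eq]
      simp [hA'def, Fin.sum_univ_two]
    rw [Real.norm_eq_abs, abs_of_nonneg (sq_nonneg _), hsq, ← hy]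
    simp only [Fin.sum_univ_three, Fin.sum_univ_two]
    fin_cases a <;> simp <;> nlinarith [sq_nonneg (A 0 y 0), sq_nonneg (A 0 y 1), sq_nonneg (A 1 y 0), sq_nonneg (A 1 y 1),
      sq_nonneg (A 2 y 0), sq_nonneg (A 2 y 1)]
  -- (Q1): divergence-free
  have hdiv : ∀ a (η : EuclideanSpace ℝ (Fin 2) → ℝ), ContDiff ℝ ∞ η → HasCompactSupport η →
      ∫ y, ∑ k : Fin 2, fderiv ℝ η y (EuclideanSpace.single k (1:ℝ)) * A' a y k = 0 := by
    intro a η hη hηc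
    have h := leftCurrents_divFree hw hw1 hcl hJ hA a hη hηc
    simpa only [hA'k] using h
  -- (H): stream functions
  obtain ⟨B, GB, hB, hGB', hEB⟩ := hH A' hA'm hA'i hdiv
  have hGB : ∀ y a, GB y (EuclideanSpace.single 0 (1:ℝ)) a = -A a y 1 ∧ GB y (EuclideanSpace.single 1 (1:ℝ)) a = A a y 0 := by
    intro y a
    obtain ⟨h0, h1⟩ := hGB' y a
    exact ⟨by rw [h0, hA'1], by rw [h1, hA'0]⟩
  -- (Q4): the H-system rows and the energy
  have hrows := fun η hη hηc a => hSystem_rows hw hw1 hE hJ hA hGB η hη hηc a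
  obtain ⟨-, hEBi, hEBeq⟩ := streamFunctions_energy hw hw1 hE hJ hA hGB
  -- (F): the quantum
  obtain ⟨k, hk⟩ := hF B GB hB hEBi hrows
  -- arithmetic
  have hΘk : Θ = 8 * Real.pi * k := by rw [← hEΘ, ← hEBeq, hk]
  have hk0 : k = 0 := nat_eq_zero_of_eight_pi_mul_le k (by rw [← hΘk]; exact hΘ)
  rw [hΘk, hk0]
  simp

end Summit.QuantumFields.YangMills.Theorems.PoincareLipschitzGapOfHSystemQuantization
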